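import Mathlib.Topology.Homotopy.HomotopyGroup
import Mathlib.Topology.Homotopy.Equiv
import Mathlib.Geometry.Manifold.ChartedSpace
import Literature.AlgebraicTopology.FundamentalGroupoid.SimplyConnectedComplPoint
import Literature.AlgebraicTopology.Homotopy.CollaredDeformationRetract
import HarnessLib

/-!
# Vanishing of homotopy groups below the dimension, by general position

Elementary homotopy theory absent from Mathlib (which has `HomotopyGroup N X x = π_N(X, x)` as a
quotient of `GenLoop N X x`, the maps `(I^N, ∂I^N) → (X, x)`, but no functoriality in `X`, no
change of base point and no computation beyond `π_0`/`π_1`), needed by route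
SmoothPoincare4/SymplecticCap (`Literature/Geometry/Symplectic/GromovMcDuffChartFormRelEnd.lean`)
to supply the hypotheses "`Σ ∖ {p}` connected with `π₂(Σ ∖ {p}) = 0`" of Gromov's recognition
theorem for a punctured homotopy 4-sphere WITHOUT Freedman's theorem. Everything is proved; the
analytic input is the general position lemma `Literature.AlgebraicTopology.FundamentalGroupoid.exists_continuousMap_eqOn_forall_ne` of
`Literature/AlgebraicTopology/FundamentalGroupoid/SimplyConnectedComplPoint.lean` (a map from a
compact uniform retract of `ℝᵐ` into a space with a Euclidean neighbourhood `ℝⁿ ⊇ U ∋ p`,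
`m < n`, can be pushed off `p` rel any closed set whose image avoids `p`).

## Main statements

* `Literature.AlgebraicTopology.Homotopy.genLoop_homotopic_const_of_free`: if `f : (I^N, ∂I^N) → (X, x)` admits a *free*
  null-homotopy `F` whose boundary values `F(t, ∂I^N) = γ(t)` move along a path `γ` from `x`
  (ending at the constant `γ 1`), then `f` is null-homotopic rel `∂I^N`. This is the
  change-of-basepoint isomorphism `β_γ : πₙ(X, γ 1) → πₙ(X, γ 0)` of Hatcher, §4.1, on the cube:
  `[f] = β_γ[const] = 0`; the two homotopies (shrink the cube concentrically and fill the collar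
  with `γ`; contract the `γ`-collar) are written with the sup-distance `cubeRad` to the centre.
* `Literature.AlgebraicTopology.Homotopy.subsingleton_homotopyGroup_of_homotopyEquiv`: if `X ≃ₕ Y` and `π_N(Y, y) = 0` for all
  `y`, then `π_N(X, x) = 0` for all `x` (Hatcher, §4.1: "a homotopy equivalence induces
  isomorphisms on all homotopy groups πₙ … even if basepoints are not required to be stationary
  during homotopies"; only the vanishing statement is formalised).
* `Literature.AlgebraicTopology.Homotopy.subsingleton_homotopyGroup_sphere`: `π_k(S) = 0` for the unit sphere `S` of a real normed
  space of dimension `> k + 1`, i.e. `π_k(Sⁿ) = 0` for `k < n` (Hatcher, Cor. 4.9). Proof by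
  the strategy Hatcher describes before Thm. 4.8 (deform to a non-surjective map, then contract
  in the complement of a point), run in one step: the linear homotopy `t y₀ + (1 - t) f` in
  `E` is nonzero on the boundary of the cylinder `I × I^k` (dimension `k + 1 < dim E`), general
  position makes it nonzero everywhere without changing these boundary values, and normalising
  gives the null-homotopy in the sphere.
* `Literature.AlgebraicTopology.Homotopy.subsingleton_homotopyGroup_compl_singleton_of_isOpenEmbedding`,
  `Literature.AlgebraicTopology.Homotopy.subsingleton_homotopyGroup_compl_singleton`: if `π_k(M) = 0` at all base points and `p`
  has a Euclidean neighbourhood of dimension `> k + 1` (e.g. `M` is a manifold of dimension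
  `≥ k + 2`), then `π_k(M ∖ {p}) = 0` at all base points (push the null-homotopy, a map from the
  `(k + 1)`-dimensional cylinder, off `p`; the case `k = 1` is
  `isSimplyConnected_compl_singleton_of_isOpenEmbedding` of `SimplyConnectedComplPoint.lean`).
* `Literature.AlgebraicTopology.Homotopy.exists_isOpenEmbedding_apply_zero_eq`: every point of a space charted on a real normed
  space `E` has a Euclidean neighbourhood `i : E → M`, `i 0 = p` (an open embedding);
  `Literature.AlgebraicTopology.Homotopy.isPathConnected_compl_singleton_of_chartedSpace`: manifold form of
  `isPathConnected_compl_singleton_of_isOpenEmbedding`.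

## References

* A. Hatcher, *Algebraic Topology*, CUP 2002, §4.1 (pp. 340–342: `β_γ`, homotopy invariance of
  `πₙ`), Thm. 4.8–Cor. 4.9 (p. 349: `πₙ(Sᵏ) = 0` for `n < k`), proof of Prop. 1.14
  [HatcherAT2002].
* A. Kosinski, *Differential Manifolds*, Academic Press 1993, VI.2 (general position off a point);
  M. Hirsch, *Differential Topology*, Springer GTM 33 (1976), Ch. 3, Thm. 2.5.
-/

noncomputable section

open Set Metric Topology unitInterval Function Module Filter
open scoped Topology.Homotopy ContinuousMap

namespace Literature.AlgebraicTopology.Homotopy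

/-! ### The cube `I^N`: sup-distance to the centre and concentric rescaling -/

section Cube

variable {N : Type*} [Fintype N]

/-- Twice the sup-distance from a point of the cube `I^N` to its centre. [folklore] -/
def cubeRad (y : N → I) : ℝ := 2 * dist (fun i => (y i : ℝ)) (fun _ => (2⁻¹ : ℝ))

/-- `0 ≤ cubeRad y`. [folklore] -/
theorem cubeRad_nonneg (y : N → I) : 0 ≤ cubeRad y :=
  mul_nonneg zero_le_two dist_nonneg

/-- `cubeRad y ≤ 1`: every coordinate of a point of the cube is within `1/2` of `1/2`.
[folklore] -/
theorem cubeRad_le_one (y : N → I) : cubeRad y ≤ 1 := by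
  have h : dist (fun i => (y i : ℝ)) (fun _ => (2⁻¹ : ℝ)) ≤ 2⁻¹ := by
    refine (dist_pi_le_iff (by norm_num)).2 fun i => ?_
    rw [Real.dist_eq, abs_le]
    constructor <;> linarith [(y i).2.1, (y i).2.2]
  unfold cubeRad; linarith

/-- `cubeRad` is continuous. [folklore] -/
@[fun_prop]
theorem continuous_cubeRad : Continuous (cubeRad : (N → I) → ℝ) := by
  unfold cubeRad
  fun_prop

/-- `cubeRad = 1` on the boundary of the cube. [folklore] -/
theorem cubeRad_eq_one_of_mem_boundary {y : N → I} (hy : y ∈ Cube.boundary N) : cubeRad y = 1 := by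
  refine le_antisymm (cubeRad_le_one y) ?_
  obtain ⟨i, hi⟩ := hy
  have h1 : dist ((y i : ℝ)) (2⁻¹ : ℝ) = 2⁻¹ := by
    rcases hi with h | h <;> rw [h, Real.dist_eq] <;> norm_num
  have h2 : dist ((y i : ℝ)) (2⁻¹ : ℝ) ≤ dist (fun i => (y i : ℝ)) (fun _ => (2⁻¹ : ℝ)) :=
    dist_le_pi_dist (fun i => (y i : ℝ)) (fun _ => (2⁻¹ : ℝ)) i
  unfold cubeRad; linarith

/-- If `0 < a ≤ cubeRad y`, some coordinate of `y` is at sup-distance `≥ a / 2` from the centre.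
[folklore] -/
theorem exists_le_abs_of_le_cubeRad {a : ℝ} (ha : 0 < a) {y : N → I} (h : a ≤ cubeRad y) :
    ∃ i, a / 2 ≤ |(y i : ℝ) - 2⁻¹| := by
  by_contra! hcon
  have : dist (fun i => (y i : ℝ)) (fun _ => (2⁻¹ : ℝ)) < a / 2 :=
    (dist_pi_lt_iff (half_pos ha)).2 fun i => by rw [Real.dist_eq]; exact hcon i
  unfold cubeRad at h; linarith

/-- Concentric rescaling of the cube by the factor `a⁻¹` about its centre, clamped to the cube.
[folklore] -/
def cubeScale (a : ℝ) (y : N → I) : N → I := fun i => clampI (2⁻¹ + ((y i : ℝ) - 2⁻¹) / a)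

omit [Fintype N] in
/-- Rescaling by the factor `1` is the identity. [folklore] -/
@[simp] theorem cubeScale_one (y : N → I) : cubeScale 1 y = y := by
  ext i
  simp [cubeScale]

/-- Rescaling by `a⁻¹`, `0 < a ≤ cubeRad y`, pushes `y` to the boundary of the cube (a coordinate
at sup-distance `≥ a / 2` from `1/2` is clamped to `0` or `1`). [folklore] -/
theorem cubeScale_mem_boundary {a : ℝ} (ha : 0 < a) {y : N → I} (h : a ≤ cubeRad y) :
    cubeScale a y ∈ Cube.boundary N := by
  obtain ⟨i, hi⟩ := exists_le_abs_of_le_cubeRad ha h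
  refine ⟨i, ?_⟩
  rcases le_abs'.1 hi with h' | h'
  · left
    apply clampI_of_nonpos
    have : ((y i : ℝ) - 2⁻¹) / a ≤ -2⁻¹ := by
      rw [div_le_iff₀ ha]; linarith
    linarith
  · right
    apply clampI_of_one_le
    have : 2⁻¹ ≤ ((y i : ℝ) - 2⁻¹) / a := by
      rw [le_div_iff₀ ha]; linarith
    linarith

omit [Fintype N] in
/-- `cubeScale a y` is jointly continuous in `(a, y)` on `a ≠ 0`. [folklore] -/
theorem continuous_cubeScale {Z : Type*} [TopologicalSpace Z] {a : Z → ℝ} {y : Z → N → I}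
    (ha : Continuous a) (ha0 : ∀ z, a z ≠ 0) (hy : Continuous y) :
    Continuous fun z => cubeScale (a z) (y z) := by
  refine continuous_pi fun i => continuous_clampI.comp ?_
  exact continuous_const.add
    (((continuous_subtype_val.comp ((continuous_apply i).comp hy)).sub continuous_const).div ha ha0)

end Cube

/-! ### A free null-homotopy whose boundary values move along a path gives a based one -/

section FreeToBased

variable {N : Type*} [Fintype N] {X : Type*} [TopologicalSpace X] {x : X}

/-- **Free null-homotopies with boundary moving along a path are as good as based ones.** Let
`f : (I^N, ∂I^N) → (X, x)` and let `F : I × I^N → X` be a homotopy starting at `f`, whose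
restriction to each `{t} × ∂I^N` is the constant `γ t` for a path `γ` from `x`, and which ends at
the constant map `γ 1`. Then `f` is null-homotopic rel `∂I^N`, i.e. trivial in `π_N(X, x)`.
(This is the change-of-basepoint isomorphism `β_γ` of Hatcher, *Algebraic Topology*, §4.1,
applied to a null class: `[f] = β_γ[const] = 0`; the homotopies are written out on the cube.)
[cite: HatcherAT2002, §4.1] -/
theorem genLoop_homotopic_const_of_free (f : Ω^ N X x) (F : C(I × (N → I), X)) (γ : C(I, X))
    (hF0 : ∀ y, F (0, y) = f y) (hFb : ∀ t, ∀ y ∈ Cube.boundary N, F (t, y) = γ t)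
    (hF1 : ∀ y, F (1, y) = γ 1) (hγ0 : γ 0 = x) :
    GenLoop.Homotopic f GenLoop.const := by
  classical
  -- Stage 1: shrink the cube concentrically and fill the collar with `γ`.
  set a : I × (N → I) → ℝ := fun z => 1 - (z.1 : ℝ) / 2 with ha_def
  have ha : Continuous a := by fun_prop
  have ha_pos : ∀ z, 0 < a z := fun z => by
    simp only [ha_def]; linarith [z.1.2.2]
  have ha_le : ∀ z, a z ≤ 1 := fun z => by
    simp only [ha_def]; linarith [z.1.2.1]
  set H₁f : I × (N → I) → X := fun z =>
    if cubeRad z.2 ≤ a z then F (z.1, cubeScale (a z) z.2)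
    else γ (clampI (2 * (1 - cubeRad z.2))) with hH₁f_def
  have hH₁c : Continuous H₁f := by
    refine Continuous.if_le ?_ ?_ (continuous_cubeRad.comp continuous_snd) ha ?_
    · exact F.continuous.comp (continuous_fst.prodMk
        (continuous_cubeScale ha (fun z => (ha_pos z).ne') continuous_snd))
    · exact γ.continuous.comp (continuous_clampI.comp (by fun_prop))
    · rintro ⟨t, y⟩ hty
      have hty' : cubeRad y = 1 - (t : ℝ) / 2 := hty
      have hb : cubeScale (a (t, y)) y ∈ Cube.boundary N :=
        cubeScale_mem_boundary (ha_pos _) hty'.symm.le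
      rw [hFb t _ hb]
      congr 1
      have : 2 * (1 - cubeRad y) = t := by rw [hty']; ring
      rw [this, clampI_coe]
  -- boundary behaviour of stage 1
  have hH₁b : ∀ (t : I), ∀ y ∈ Cube.boundary N, H₁f (t, y) = x := by
    intro t y hy
    have hr : cubeRad y = 1 := cubeRad_eq_one_of_mem_boundary hy
    simp only [hH₁f_def]
    split_ifs with h
    · have ht0 : (t : ℝ) = 0 := by
        have h' : cubeRad y ≤ 1 - (t : ℝ) / 2 := h
        rw [hr] at h'
        linarith [t.2.1]
      have ht : t = 0 := Subtype.ext ht0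
      rw [hFb t _ (cubeScale_mem_boundary (ha_pos _) ((ha_le (t, y)).trans hr.ge)), ht, hγ0]
    · rw [hr, sub_self, mul_zero, clampI_zero, hγ0]
  -- the intermediate loop `g₁ = H₁f (1, ·)`
  let g₁ : Ω^ N X x := ⟨⟨fun y => H₁f (1, y), hH₁c.comp (continuous_const.prodMk continuous_id)⟩,
    fun y hy => hH₁b 1 y hy⟩
  have h₁ : GenLoop.Homotopic f g₁ := by
    refine ⟨{ toFun := H₁f
              continuous_toFun := hH₁c
              map_zero_left := fun y => ?_
              map_one_left := fun y => rfl
              prop' := fun t y hy => ?_ }⟩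
    · show H₁f (0, y) = f y
      have h0 : a (0, y) = 1 := by simp [ha_def]
      simp only [hH₁f_def, h0, if_pos (cubeRad_le_one y), cubeScale_one]
      exact hF0 y
    · show H₁f (t, y) = f y
      rw [hH₁b t y hy]
      exact (f.2 y hy).symm
  -- Stage 2: contract the `γ`-collar around the constant `γ 1` to the constant `x = γ 0`.
  set H₂f : I × (N → I) → X := fun z =>
    γ (clampI ((1 - (z.1 : ℝ)) * min 1 (2 * (1 - cubeRad z.2)))) with hH₂f_def
  have hH₂c : Continuous H₂f := by
    refine γ.continuous.comp (continuous_clampI.comp ?_)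
    fun_prop [continuous_cubeRad]
  have h₂ : GenLoop.Homotopic g₁ GenLoop.const := by
    refine ⟨{ toFun := H₂f
              continuous_toFun := hH₂c
              map_zero_left := fun y => ?_
              map_one_left := fun y => ?_
              prop' := fun t y hy => ?_ }⟩
    · show H₂f (0, y) = H₁f (1, y)
      have h1 : a (1, y) = 2⁻¹ := by simp [ha_def]; norm_num
      simp only [hH₂f_def, hH₁f_def, h1]
      simp only [Icc.coe_zero, sub_zero, one_mul]
      split_ifs with h
      · rw [min_eq_left (by linarith), clampI_one, hF1]
      · rw [min_eq_right (by linarith)]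
    · show H₂f (1, y) = x
      simp [hH₂f_def, hγ0]
    · show H₂f (t, y) = H₁f (1, y)
      rw [hH₁b 1 y hy]
      simp [hH₂f_def, cubeRad_eq_one_of_mem_boundary hy, hγ0]
  exact h₁.trans h₂

end FreeToBased

/-! ### Vanishing of `π_N` is a homotopy invariant -/

section HomotopyInvariance

variable {N : Type*} [Fintype N] {X Y : Type*} [TopologicalSpace X] [TopologicalSpace Y]

omit [Fintype N] in
/-- `π_N(X, x)` is trivial iff every `N`-loop at `x` is null-homotopic rel `∂I^N`. [folklore] -/
theorem subsingleton_homotopyGroup_iff {x : X} :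
    Subsingleton (HomotopyGroup N X x) ↔ ∀ f : Ω^ N X x, GenLoop.Homotopic f GenLoop.const := by
  constructor
  · intro h f
    exact Quotient.exact (Subsingleton.elim (α := HomotopyGroup N X x) ⟦f⟧ ⟦GenLoop.const⟧)
  · intro h
    constructor
    intro a b
    induction a using Quotient.inductionOn
    induction b using Quotient.inductionOn
    exact Quotient.sound ((h _).trans (h _).symm)

/-- **Triviality of `π_N` passes to homotopy-dominated spaces.** If `φ : X → Y` has a left
homotopy inverse `ψ` (`ψ ∘ φ ≃ id`, basepoints free to move; "`X` is dominated by `Y`") and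
`π_N(Y, φ x) = 0`, then `π_N(X, x) = 0`:
a null-homotopy of `φ ∘ f` in `Y` is pulled back by `ψ` and composed with the free homotopy
`ψ ∘ φ ∘ f ≃ f`, whose boundary values run along the track of `x`; then
`genLoop_homotopic_const_of_free` applies (Hatcher, *Algebraic Topology*, §4.1: homotopy
equivalences induce isomorphisms on all `πₙ` "even if basepoints are not required to be
stationary during homotopies"). [cite: HatcherAT2002, §4.1] -/
theorem subsingleton_homotopyGroup_of_leftHomotopyInverse (φ : C(X, Y)) (ψ : C(Y, X))
    (hψφ : (ψ.comp φ).Homotopic (ContinuousMap.id X)) (x : X)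
    (hY : Subsingleton (HomotopyGroup N Y (φ x))) : Subsingleton (HomotopyGroup N X x) := by
  classical
  obtain ⟨G⟩ := hψφ
  rw [subsingleton_homotopyGroup_iff] at hY ⊢
  intro f
  -- push `f` forward to `Y` and contract it there
  have hfb : ∀ y ∈ Cube.boundary N, f y = x := fun y hy => f.2 y hy
  let φf : Ω^ N Y (φ x) := ⟨φ.comp f.1, fun y hy => by
    show φ (f y) = φ x
    rw [hfb y hy]⟩
  obtain ⟨K⟩ := hY φf
  -- the free null-homotopy of `f`: first `f ≃ ψ ∘ φ ∘ f` along `G` (reversed), then `ψ ∘ K`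
  set Ff : I × (N → I) → X := fun z =>
    if (z.1 : ℝ) ≤ 2⁻¹ then G (clampI (1 - 2 * z.1), f z.2) else ψ (K (clampI (2 * z.1 - 1), z.2))
    with hFf_def
  have hFc : Continuous Ff := by
    refine Continuous.if_le ?_ ?_ (continuous_subtype_val.comp continuous_fst) continuous_const ?_
    · exact G.continuous.comp ((continuous_clampI.comp (by fun_prop)).prodMk
        (f.1.continuous.comp continuous_snd))
    · exact ψ.continuous.comp (K.continuous.comp ((continuous_clampI.comp (by fun_prop)).prodMk
        continuous_snd))
    · rintro ⟨t, y⟩ ht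
      simp only at ht
      have h1 : clampI (1 - 2 * (t : ℝ)) = 0 := by rw [ht]; norm_num
      have h2 : clampI (2 * (t : ℝ) - 1) = 0 := by rw [ht]; norm_num
      simp only [h1, h2, G.apply_zero, K.apply_zero]
      rfl
  set γf : I → X := fun t => if (t : ℝ) ≤ 2⁻¹ then G (clampI (1 - 2 * t), x) else ψ (φ x)
    with hγf_def
  have hγc : Continuous γf := by
    refine Continuous.if_le ?_ continuous_const continuous_subtype_val continuous_const ?_
    · exact G.continuous.comp ((continuous_clampI.comp (by fun_prop)).prodMk continuous_const)
    · intro t ht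
      have h1 : clampI (1 - 2 * (t : ℝ)) = 0 := by rw [ht]; norm_num
      simp only [h1, G.apply_zero]
      rfl
  refine genLoop_homotopic_const_of_free f ⟨Ff, hFc⟩ ⟨γf, hγc⟩ (fun y => ?_) (fun t y hy => ?_)
    (fun y => ?_) ?_
  · show Ff (0, y) = f y
    simp [hFf_def]
  · show Ff (t, y) = γf t
    simp only [hFf_def, hγf_def]
    split_ifs with h
    · rw [hfb y hy]
    · simp [K.eq_fst _ hy, φf, hfb y hy]
  · show Ff (1, y) = γf 1
    have h : ¬ ((1 : ℝ) ≤ 2⁻¹) := by norm_num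
    have h1 : clampI (2 - 1) = 1 := by norm_num
    simp only [hFf_def, hγf_def, Icc.coe_one, h, if_false, mul_one, h1, K.apply_one]
    rfl
  · show γf 0 = x
    simp [hγf_def]

/-- **Vanishing of `π_N` is invariant under homotopy equivalence** (at every base point):
if `X ≃ₕ Y` and `π_N(Y, y) = 0` for all `y`, then `π_N(X, x) = 0` for all `x`
(Hatcher, *Algebraic Topology*, §4.1). [cite: HatcherAT2002, §4.1] -/
theorem subsingleton_homotopyGroup_of_homotopyEquiv (e : X ≃ₕ Y)
    (hY : ∀ y : Y, Subsingleton (HomotopyGroup N Y y)) (x : X) :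
    Subsingleton (HomotopyGroup N X x) :=
  subsingleton_homotopyGroup_of_leftHomotopyInverse e.toFun e.invFun e.left_inv x (hY _)

end HomotopyInvariance

/-! ### `π_k(Sⁿ) = 0` for `k < n` -/

section Sphere

variable {N : Type*} [Fintype N]

/-- The boundary of the cube `I^N` (`N` finite) is closed. [folklore] -/
theorem isClosed_cubeBoundary : IsClosed (Cube.boundary N) := by
  have : Cube.boundary N = ⋃ i, ({y | y i = 0} ∪ {y | y i = 1}) := by
    ext y; simp [Cube.boundary]
  rw [this]
  exact isClosed_iUnion_of_finite fun i =>
    (isClosed_eq (continuous_apply i) continuous_const).union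
      (isClosed_eq (continuous_apply i) continuous_const)

/-- Bottom, top and sides of the cylinder `I × I^N`. [folklore] -/
def cylBoundary (N : Type*) : Set (I × (N → I)) :=
  {z | z.1 = 0} ∪ ({z | z.1 = 1} ∪ {z | z.2 ∈ Cube.boundary N})

/-- `cylBoundary N` is closed (`N` finite). [folklore] -/
theorem isClosed_cylBoundary : IsClosed (cylBoundary N) :=
  (isClosed_eq continuous_fst continuous_const).union
    ((isClosed_eq continuous_fst continuous_const).union
      (isClosed_cubeBoundary.preimage continuous_snd))

/-- `I × I^k` is a uniform retract of `ℝ × ℝ^k` (clamping), of dimension `k + 1`. [folklore] -/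
theorem retract_unitCylinder (k : ℕ) :
    Continuous (fun z : I × (Fin k → I) => ((z.1 : ℝ), fun i => (z.2 i : ℝ))) ∧
      UniformContinuous (fun w : ℝ × (Fin k → ℝ) => (clampI w.1, fun i => clampI (w.2 i))) ∧
      (∀ z : I × (Fin k → I), (clampI (z.1 : ℝ), fun i => clampI ((z.2 i : ℝ))) = z) ∧
      finrank ℝ (ℝ × (Fin k → ℝ)) = k + 1 := by
  refine ⟨by fun_prop, ?_, fun z => by simp, ?_⟩
  · refine ((LipschitzWith.projIcc _).uniformContinuous.comp uniformContinuous_fst).prodMk ?_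
    exact uniformContinuous_pi.2 fun i =>
      (LipschitzWith.projIcc _).uniformContinuous.comp
        ((Pi.uniformContinuous_proj _ i).comp uniformContinuous_snd)
  · rw [Module.finrank_prod, Module.finrank_self, Module.finrank_fin_fun]; ring

variable {E : Type*} [NormedAddCommGroup E] [NormedSpace ℝ E] [FiniteDimensional ℝ E]

/-- **`π_k(Sⁿ) = 0` for `k < n`** (Hatcher, *Algebraic Topology*, Cor. 4.9), for the unit sphere
of a real normed space `E` of dimension `n + 1 > k + 1`, at every base point. Proof by general
position instead of cellular approximation: for `f : (I^k, ∂) → (S, y₀)` the linear homotopy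
`t y₀ + (1 - t) f` in `E` is nonzero on the boundary of the cylinder `I × I^k`
(dimension `k + 1 < dim E`), so it can be pushed off the origin keeping these boundary values
(`exists_continuousMap_eqOn_forall_ne`); normalising gives a null-homotopy of `f` rel `∂I^k`
in the sphere. [cite: HatcherAT2002, Cor. 4.9] -/
theorem subsingleton_homotopyGroup_sphere {k : ℕ} (hk : k + 1 < finrank ℝ E)
    (y₀ : sphere (0 : E) 1) : Subsingleton (HomotopyGroup (Fin k) (sphere (0 : E) 1) y₀) := by
  rw [subsingleton_homotopyGroup_iff]
  intro f
  obtain ⟨hι, hπ, hπι, h1⟩ := retract_unitCylinder k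
  -- the linear homotopy in `E` from `f` to the constant `y₀`
  let F : C(I × (Fin k → I), E) :=
    ⟨fun z => (z.1 : ℝ) • (y₀ : E) + (1 - (z.1 : ℝ)) • ((f z.2 : sphere (0 : E) 1) : E), by
      fun_prop⟩
  have hy₀ : (y₀ : E) ≠ 0 := ne_zero_of_mem_unit_sphere y₀
  have hFZ : ∀ z ∈ cylBoundary (Fin k), F z ≠ id 0 := by
    rintro ⟨t, y⟩ hz
    simp only [id_eq]
    rcases hz with h | h | h
    · simp only [mem_setOf_eq] at h
      subst h
      simpa [F] using ne_zero_of_mem_unit_sphere (f y)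
    · simp only [mem_setOf_eq] at h
      subst h
      simpa [F] using hy₀
    · simp only [mem_setOf_eq] at h
      have hfy : f y = y₀ := f.2 y h
      simp only [F, ContinuousMap.coe_mk, hfy]
      rw [← add_smul]
      simpa using hy₀
  obtain ⟨g, hgZ, hg⟩ := FundamentalGroupoid.exists_continuousMap_eqOn_forall_ne hι hπ hπι (h1.symm ▸ hk)
    IsOpenEmbedding.id F isClosed_cylBoundary hFZ
  simp only [id_eq] at hg
  -- normalise
  have hgn : ∀ z, ‖g z‖ ≠ 0 := fun z => norm_ne_zero_iff.2 (hg z)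
  let H : I × (Fin k → I) → sphere (0 : E) 1 := fun z =>
    ⟨‖g z‖⁻¹ • g z, by rw [mem_sphere_zero_iff_norm, norm_smul, norm_inv, norm_norm,
      inv_mul_cancel₀ (hgn z)]⟩
  have hHc : Continuous H :=
    (((continuous_norm.comp g.continuous).inv₀ hgn).smul g.continuous).subtype_mk _
  have hHval : ∀ z ∈ cylBoundary (Fin k), (H z : E) = F z := by
    intro z hz
    show ‖g z‖⁻¹ • g z = F z
    rw [hgZ hz]
    rcases z with ⟨t, y⟩
    rcases hz with h | h | h <;> simp only [mem_setOf_eq] at h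
    · subst h; simp [F]
    · subst h; simp [F]
    · have hfy : f y = y₀ := f.2 y h
      simp only [F, ContinuousMap.coe_mk, hfy]
      rw [← add_smul]
      simp
  refine ⟨{ toFun := H
            continuous_toFun := hHc
            map_zero_left := fun y => ?_
            map_one_left := fun y => ?_
            prop' := fun t y hy => ?_ }⟩
  · apply Subtype.ext
    show (H (0, y) : E) = (f y : E)
    rw [hHval _ (Or.inl rfl)]
    simp [F]
  · apply Subtype.ext
    show (H (1, y) : E) = (GenLoop.const (N := Fin k) (x := y₀) y : E)
    rw [hHval _ (Or.inr (Or.inl rfl))]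
    simp [F, GenLoop.const]
  · apply Subtype.ext
    show (H (t, y) : E) = (f y : E)
    rw [hHval _ (Or.inr (Or.inr hy))]
    have hfy : f y = y₀ := f.2 y hy
    simp only [F, ContinuousMap.coe_mk, hfy]
    rw [← add_smul]
    simp

end Sphere

/-! ### Removing a point: `π_k(M ∖ p) = 0` if `π_k(M) = 0` and `k + 2 ≤ dim M` -/

section ComplPoint

variable {E : Type*} [NormedAddCommGroup E] [NormedSpace ℝ E] [FiniteDimensional ℝ E]
  {M : Type*} [TopologicalSpace M] [T2Space M] {i : E → M}

/-- **Removing a point of a manifold of dimension `≥ k + 2` preserves `π_k = 0`.** If `p ∈ M`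
has a Euclidean neighbourhood `i : E ≅ U ∋ p = i 0` with `k + 1 < dim E` in the Hausdorff space
`M`, and `π_k(M, x) = 0` for all `x`, then `π_k(M ∖ {p}, x) = 0` for all `x`: a null-homotopy
in `M` of a `k`-loop of `M ∖ {p}` is a map from the `(k + 1)`-dimensional cylinder, which
general position (`exists_continuousMap_eqOn_forall_ne`) pushes off `p` without changing its
boundary values (the injectivity of `π_k(M ∖ p) → π_k(M)` for `k ≤ dim M - 2`; Kosinski,
*Differential Manifolds* (1993), VI.2; Hatcher, *Algebraic Topology* (2002), proof of
Prop. 1.14, for `k = 1`). [folklore] -/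
theorem subsingleton_homotopyGroup_compl_singleton_of_isOpenEmbedding (hi : IsOpenEmbedding i)
    {k : ℕ} (hk : k + 1 < finrank ℝ E)
    (hM : ∀ x : M, Subsingleton (HomotopyGroup (Fin k) M x)) (x : ({i 0}ᶜ : Set M)) :
    Subsingleton (HomotopyGroup (Fin k) ({i 0}ᶜ : Set M) x) := by
  rw [subsingleton_homotopyGroup_iff]
  intro f
  obtain ⟨hι, hπ, hπι, h1⟩ := retract_unitCylinder k
  -- the loop in `M` and a null-homotopy there
  let fM : Ω^ (Fin k) M (x : M) :=
    ⟨(⟨Subtype.val, continuous_subtype_val⟩ : C(({i 0}ᶜ : Set M), M)).comp f.1, fun y hy => by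
      show ((f y : ({i 0}ᶜ : Set M)) : M) = x
      rw [show f y = x from f.2 y hy]⟩
  have hMx := hM (x : M)
  rw [subsingleton_homotopyGroup_iff] at hMx
  obtain ⟨K⟩ := hMx fM
  have hKZ : ∀ z ∈ cylBoundary (Fin k), K.toContinuousMap z ≠ i 0 := by
    rintro ⟨t, y⟩ hz
    change K (t, y) ≠ i 0
    rcases hz with h | h | h <;> simp only [mem_setOf_eq] at h
    · subst h; rw [K.apply_zero]; exact (f y).2
    · subst h; rw [K.apply_one]; exact x.2
    · rw [K.eq_fst _ h]; exact (f y).2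
  obtain ⟨g, hgZ, hg⟩ := FundamentalGroupoid.exists_continuousMap_eqOn_forall_ne hι hπ hπι (h1.symm ▸ hk) hi
    K.toContinuousMap isClosed_cylBoundary hKZ
  have hgK : ∀ z ∈ cylBoundary (Fin k), g z = K z := fun z hz => hgZ hz
  let G : C(I × (Fin k → I), ({i 0}ᶜ : Set M)) := ⟨fun z => ⟨g z, hg z⟩, g.continuous.subtype_mk _⟩
  refine ⟨{ toFun := G
            continuous_toFun := G.continuous
            map_zero_left := fun y => ?_
            map_one_left := fun y => ?_
            prop' := fun t y hy => ?_ }⟩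
  · apply Subtype.ext
    show g (0, y) = (f y : M)
    rw [hgK _ (Or.inl rfl), K.apply_zero]
    rfl
  · apply Subtype.ext
    show g (1, y) = (x : M)
    rw [hgK _ (Or.inr (Or.inl rfl)), K.apply_one]
    rfl
  · apply Subtype.ext
    show g (t, y) = (f y : M)
    rw [hgK _ (Or.inr (Or.inr hy)), K.eq_fst _ hy]
    rfl

end ComplPoint

/-! ### Euclidean neighbourhoods of points of a manifold -/

section Chart

variable {E : Type*} [NormedAddCommGroup E] [NormedSpace ℝ E] {M : Type*} [TopologicalSpace M]
  [ChartedSpace E M]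

/-- Every point `p` of a manifold (a space charted on the real normed space `E`) has a Euclidean
neighbourhood in the sense of `SimplyConnectedComplPoint.lean`: an open embedding `i : E → M`
with `i 0 = p` (a ball in the chart at `p`, reparametrised by `OpenPartialHomeomorph.univBall`).
[folklore] -/
theorem exists_isOpenEmbedding_apply_zero_eq (p : M) :
    ∃ i : E → M, IsOpenEmbedding i ∧ i 0 = p := by
  set c := chartAt E p with hc
  obtain ⟨r, hr, hball⟩ : ∃ r > 0, ball (c p) r ⊆ c.target :=
    Metric.isOpen_iff.1 c.open_target (c p) (c.map_source (mem_chart_source E p))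
  set u := OpenPartialHomeomorph.univBall (c p) r with hu
  have hu_src : u.source = univ := OpenPartialHomeomorph.univBall_source (c p) r
  have hu_tgt : u.target = ball (c p) r := OpenPartialHomeomorph.univBall_target (c p) hr
  set e := u.trans c.symm with he
  have he_src : e.source = univ := by
    rw [he, OpenPartialHomeomorph.trans_source, hu_src, univ_inter, eq_univ_iff_forall]
    intro v
    show u v ∈ c.symm.source
    rw [c.symm_source]
    exact hball (hu_tgt ▸ u.map_source (hu_src.symm ▸ mem_univ v))
  refine ⟨e, e.to_isOpenEmbedding he_src, ?_⟩
  show c.symm (u 0) = p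
  rw [hu, OpenPartialHomeomorph.univBall_apply_zero]
  exact c.left_inv (mem_chart_source E p)

variable [T2Space M] [FiniteDimensional ℝ E]

/-- **Removing a point from a manifold of dimension `≥ k + 2` with `π_k = 0` leaves `π_k = 0`**,
manifold version of `subsingleton_homotopyGroup_compl_singleton_of_isOpenEmbedding`: for `M`
Hausdorff and charted on `E` with `k + 1 < dim E`, if `π_k(M, x) = 0` for all `x` then
`π_k(M ∖ {p}, x) = 0` for all `p`, `x`. [folklore] -/
theorem subsingleton_homotopyGroup_compl_singleton {k : ℕ} (hk : k + 1 < finrank ℝ E)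
    (hM : ∀ x : M, Subsingleton (HomotopyGroup (Fin k) M x)) (p : M) (x : ({p}ᶜ : Set M)) :
    Subsingleton (HomotopyGroup (Fin k) ({p}ᶜ : Set M) x) := by
  obtain ⟨i, hi, hip⟩ := exists_isOpenEmbedding_apply_zero_eq (E := E) p
  subst hip
  exact subsingleton_homotopyGroup_compl_singleton_of_isOpenEmbedding hi hk hM x

/-- **Removing a point from a path connected manifold of dimension `≥ 2` leaves it path
connected**, manifold version of `isPathConnected_compl_singleton_of_isOpenEmbedding`.
[folklore] -/
theorem isPathConnected_compl_singleton_of_chartedSpace [PathConnectedSpace M]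
    (h2 : 1 < finrank ℝ E) (p : M) : IsPathConnected ({p}ᶜ : Set M) := by
  obtain ⟨i, hi, hip⟩ := exists_isOpenEmbedding_apply_zero_eq (E := E) p
  subst hip
  exact FundamentalGroupoid.isPathConnected_compl_singleton_of_isOpenEmbedding hi h2

end Chart

end Literature.AlgebraicTopology.Homotopy
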